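/-
Copyright (c) 2026 the pub-hodgecm2 formalisation cell (harness21).  New file.
Origin: seat `prover-pub-hodgecm2-item6-p2-g11-0` (unit pub-hodgecm2-item6-p2, TRANSPOSITION item (vi) extra prover p2 = the (J3)
placement-junction lineage, gen 11), 2026-08-22 — composition BY NAME of pin-3's Δ2-in-one-theorem over the PORTED codes
(`Item6PlacementJunctionAppendixCPkg.lean`, p313477) with tr-prover-6 / item6-p1's X1 RECORDS (`Liu2021/Thm418ProofMapRational.lean`
p314297, `Liu2021/Thm418CombinedOfRecords.lean` p316641): the three X1 binders (J) `J` / `hJ` / `hJinj` and the object binder `Dμ`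
of p313477 are DISCHARGED over a rational record `M μ : Map43RationalData`, read into the consumer's carrier `T.H` along ONE
equivariant injection `jH μ`; the class binder is stated on Liu's OWN classes (no (4.3) in it).  KERNEL only; theorems only; no
definition, no named fact introduced; count-neutral; HC_CM is NOT proved; «Δ2 BRIDGE CLOSED» is NOT claimed.
-/
import Summits.HodgeConjecture.CorCM.B01.Transposition.Item6PlacementJunctionAppendixCPkg
import Literature.NumberTheory.Automorphic.Liu2021.Thm418CombinedOfRecords
import HarnessLib

set_option autoImplicit false

/-!
# Δ2 in one theorem over the PORTED codes AND the X1 RECORDS: `Thm418AsPrintedC C (R μ)` + (σ, e) + a rational record `M μ` of the proof's objects + (C) on Liu's own classes + D-side `hnv`/`hmult` ⟹ `T.Thm418Combined res cmCl`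

WHY THIS FILE.  p313477 (`Item6PlacementJunctionAppendixCPkg.lean`) concludes the package's combined reading r8
`T.Thm418Combined res cmCl` for every record `T` over the PORTED group `↥V.adelicFin` and the PORTED levels `HodgeCM.Level.K` — the
exact type of `(HodgeCM.Model.liuDictionaryPin …).toLiuAlbaneseModuleDatum`, whose `Thm418C` is the `h418` binder of the ported head
(`CorCM/PortJoin/Closed.lean`, port layer 96) — from [Liu2021, Thm. 4.18] EXACTLY AS PRINTED at an Appendix-C datum plus, per
character `μ` with `τ' ∈ Φ_μ`, the X1 binders (J) `J μ` (the proof map (4.3) read into `T.H`), `hJ μ` («`ℂ[𝔾(𝔸_F^∞)]`-linear»,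
l. 2250) and `hJinj μ` («injective», l. 2250–2268), an object `Dμ μ`, and the class identification `hpin μ` stated THROUGH `J μ`.
Since then the X1 lineage landed the RATIONAL RECORD of the proof's objects, `Map43RationalData` (`Thm418ProofMapRational.lean`,
item6-p1, p314297: `D_μ`, `τ'`, `H¹_{B,τ'}(A_∞, ℚ)` with its Hecke action `ρU`, the complex carrier `HB` with `ρB` and the injective
equivariant comparison `ι`, `H¹_{B,τ'}(A_μ, ℚ)` an `M_μ`-line, Liu's chosen `α`, and `f ↦ f^*` with its laws `P_smul`/`P_comm`/
`P_injective`), over which (ii) `hJ` and (iii) `hJinj` are THEOREMS (`Map43RationalData.hJ`, `Map43RationalData.injective_J`, the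
latter with `H¹_{B,τ'}(A_μ, ℚ)` finite over `ℚ` DERIVED by `Map43RationalData.finite_rat_L`, tr-prover-6 p316641).
This file is the one-application composition: p313477's binder list with {`J`, `hJ`, `hJinj`, `Dμ`, `hpin`} REPLACED by
* `M μ hμ : (toThm418Data C (R μ hμ)).Map43RationalData` — the record (its `Dμ` is the object);
* `jH μ hμ : (M μ hμ).HB →ₗ[ℂ] T.H`, injective (`hjHinj`) and `𝔾(𝔸_F^∞)`-equivariant from `ρB` to the consumer's `ℂ[↥V.adelicFin]`-module
  structure on `T.H` (`hjH`) — the reading «the record's complex carrier `H¹_{B,τ'}(A_∞, ℂ)` IS (a sub-`ℂ[G]`-module of) `T.H`»; at an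
  honest pin `M` is built with `HB := T.H`, `ρB :=` the action of `T.H`, and `jH := LinearMap.id`;
* `hcm μ hμ K φ` — the class identification on LIU'S OWN classes, with NO (4.3) in it: the level-`K` restriction under `res K` of
  `jH (ι ((φ^*)_ℂ α))`, `φ ∈ Hom_E(A_K, A_μ)_ℚ` — `= (φ^*α)|_{X_K}` by [Liu2021] Lem. 2.4 (1) (l. 1210–1213) — lies in the consumer's
  class set `cmCl K μ` (for the package: the comprehension `cmClasses K μ ⊇` the classes of `d = (A_μ, α)`, the `adm` CONTRACT X2b).
KERNEL: `J μ hμ := jH μ hμ ∘ₗ (M μ hμ).toMap43Data.J`; `hJinj` = `hjHinj ∘ Map43RationalData.injective_J` (after `finite_rat_L`);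
`hJ` = `Map43RationalData.hJ` then `hjH`; `hpin` from `hcm` by `Map43RationalData.J_tmul` at `z = 1`; then p313477's
`thm418Combined_of_thm418AsPrintedC_summands_pkg` VERBATIM.  WHAT REMAINS of Δ2 after this file: inhabiting, at the dictionary pin
(port layers 45/67), the Appendix-C datum `C` with its rests `R μ` and the cite `hLiu μ` (S-lane carriers), the summand identifications
`σ`/`e` (X3 «ω ↔ Ω»), ONE rational record `M μ` per `μ` with its reading `jH μ` into the honest tower (X1 INSTANCE half — a
CONSTRUCTION, port-gated), the contract `hcm`, and the two D-side printed sentences `hnvD` (Def. 4.11 / Lem. D.1 (1)) and `hmultD`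
(proof of Prop. 4.13, l. 2145).  HC_CM is NOT proved; no pin is discharged here; nothing about Liu's objects is constructed.

References: Y. Liu, *Fourier–Jacobi cycles and arithmetic relative trace formula*, Camb. J. Math. 9 (2021) = arXiv:2102.11518
(`FJcycle.tex` md5 6db49a74122d): Lem. 2.4 (1) l. 1210–1213, §4.2 l. 2053–2074, Def. 4.5 (2) l. 1944–1952, Def. 4.11 l. 2083–2097,
Prop. 4.13 (proof l. 2145), Def. 4.16 l. 2215–2224, Thm. 4.18 l. 2232–2245 with proof and map (4.3) l. 2247–2268, App. C l. 4618–4637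
(Prop. C.5), App. D Lem. D.1 (1).  Tree: p313477, p308232 (pin-3); p314297 (item6-p1); p316641, p306398 (tr-prover-6); rows A /
Transport / Along of this lineage (p305984 / p307200 / p308282).
-/

noncomputable section

open scoped DirectSum TensorProduct

namespace HodgeCM.Literature.Theta

namespace LiuAlbaneseModuleDatum

open Summit.HodgeConjecture.CorCM
open Literature.AlgebraicGeometry.ShimuraVarieties.UnitaryCanonicalModel
open Literature.NumberTheory.Automorphic.Liu2021 Literature.NumberTheory.Automorphic.Liu2021.AppendixC NumberField

universe w

/-- **Δ2 IN ONE THEOREM, SUMMAND FORM, OVER THE PORTED CODES AND THE X1 RECORDS — [Liu2021, Thm. 4.18] AS PRINTED at the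
Appendix-C datum + per-summand identifications + ONE rational record of the proof's objects per `μ`, read into `T.H` + the class
contract on Liu's own classes + the D-side printed sentences ⟹ the package's combined reading r8 `T.Thm418Combined res cmCl`** for every
record `T` over the PORTED group `↥V.adelicFin` and the PORTED levels `HodgeCM.Level.K` of a ported `V : HodgeCM.HermSpace3 L ι₁`.
Binders: `h` ([Deligne1979] 2.2.5 / 2.7.21, the named fact behind the honest App-C datum), `Φ`; ONE §4.2 datum `C` (l. 2053–2074) at
`honestP5Of h ⟨L.K⟩ ι₁ ⟨V.Hm, …⟩ Φ` (App. C l. 4618–4624, Prop. C.5; group `= ↥V.adelicFin` by `rfl`); per `μ` with `τ' ∈ Φ_μ`: `R μ`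
(Def. 4.5 (2), Def. 4.11, Def. 4.16), `hLiu μ` = Thm. 4.18 EXACTLY AS PRINTED (l. 2232–2245) for `toThm418Data C (R μ)`, (Ω) `σ μ`
injective (`hσ`) with `e μ a : T.Ω μ a ≃ ω(μ, σ a)` equivariant (`he`), (X1 RECORDS) `M μ : Map43RationalData` — `D_μ`, `τ'`,
`H¹_{B,τ'}(A_∞, ℚ)` ∕ `H¹_{B,τ'}(A_∞, ℂ)` with the Hecke actions and the comparison, `H¹_{B,τ'}(A_μ, ℚ)` as an `M_μ`-line, `α`, `f ↦ f^*`
(l. 650, l. 2074–2081, Def. 4.5 (2), l. 2247–2253) — with its reading `jH μ : H¹_{B,τ'}(A_∞, ℂ) → T.H`, injective (`hjHinj`) and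
equivariant (`hjH`), (C) `hcm μ` on Liu's own classes `(φ^*α)|_{X_K}` (Lem. 2.4 (1) l. 1210–1213 + the `cmCl` contract), `hnvD μ`
(Def. 4.11 / Lem. D.1 (1)) and `hmultD μ` (proof of Prop. 4.13, l. 2145) ON LIU'S SUMMANDS.  The X1 binders of p313477 are THEOREMS
here: `J μ := jH μ ∘ (4.3)`, «`ℂ[𝔾(𝔸_F^∞)]`-linear» = `Map43RationalData.hJ` + `hjH`, «injective» = `Map43RationalData.injective_J`
(finiteness by `finite_rat_L`) + `hjHinj`; `hpin` = `hcm` via `Map43RationalData.J_tmul`.  KERNEL: p313477's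
`thm418Combined_of_thm418AsPrintedC_summands_pkg` at these arguments.  HC_CM is NOT proved; no pin is discharged here; nothing is
asserted about Liu's objects; «Δ2 BRIDGE CLOSED» is NOT claimed.
[cite: Liu2021, Thm. 4.18 (FJcycle.tex l. 2232–2245) with proof l. 2247–2268 and map (4.3) l. 2250–2253, Thm. 4.18 (1) (l. 2239), Lem. 2.4 (1) (l. 1210–1213), Prop. 4.13 proof l. 2145, Def. 4.5 (2) (l. 1944–1952), Def. 4.11, App. D Lem. D.1 (1), §4.2 l. 2053–2081, App. C l. 4618–4624, Prop. C.5 (l. 4624–4637)]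
[cite: Deligne1979ShimuraVarieties, 2.2.5 and Cor. 2.7.21] -/
theorem thm418Combined_of_thm418AsPrintedC_summands_records
    {L : HodgeCM.CMField} {ι₁ : L →+* ℂ} (V : HodgeCM.HermSpace3 L ι₁)
    (h : exists_recordSystem) (Φ : Literature.AlgebraicGeometry.Motives.CMType L)
    {isotropicAt : ℕ → Prop}
    (C : Sec42Data (Model.honestP5Of h ⟨L.K⟩ ι₁ ⟨V.Hm, V.isHermitian, V.signature_ι₁, V.posDef_of_ne⟩ Φ) isotropicAt)
    (T : LiuAlbaneseModuleDatum ↥V.adelicFin (HodgeCM.Level.K : HodgeCM.Level V → Subgroup ↥V.adelicFin))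
    {W : HodgeCM.Level V → Type w} [∀ K, AddCommGroup (W K)] [∀ K, Module ℂ (W K)]
    (res : ∀ K : HodgeCM.Level V, T.H →ₗ[ℂ] W K) (cmCl : ∀ K : HodgeCM.Level V, T.Char → Set (W K))
    (R : ∀ μ : T.Char, T.PhiMu μ → Thm418Rest C)
    (hLiu : ∀ (μ : T.Char) (hμ : T.PhiMu μ), Thm418AsPrintedC C (R μ hμ))
    (σ : ∀ (μ : T.Char) (hμ : T.PhiMu μ), T.Adm μ → (toThm418Data C (R μ hμ)).AdmIndex)
    (hσ : ∀ (μ : T.Char) (hμ : T.PhiMu μ), Function.Injective (σ μ hμ))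
    (e : ∀ (μ : T.Char) (hμ : T.PhiMu μ) (a : T.Adm μ), T.Ω μ a ≃ₗ[ℂ] (toThm418Data C (R μ hμ)).omegaAt (σ μ hμ a))
    (he : ∀ (μ : T.Char) (hμ : T.PhiMu μ) (a : T.Adm μ) (g : ↥V.adelicFin) (m : T.Ω μ a),
      e μ hμ a (MonoidAlgebra.of ℂ ↥V.adelicFin g • m) = (toThm418Data C (R μ hμ)).rhoAt (σ μ hμ a) g (e μ hμ a m))
    (M : ∀ (μ : T.Char) (hμ : T.PhiMu μ), (toThm418Data C (R μ hμ)).Map43RationalData)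
    (jH : ∀ (μ : T.Char) (hμ : T.PhiMu μ), (M μ hμ).HB →ₗ[ℂ] T.H)
    (hjHinj : ∀ (μ : T.Char) (hμ : T.PhiMu μ), Function.Injective (jH μ hμ))
    (hjH : ∀ (μ : T.Char) (hμ : T.PhiMu μ) (g : ↥V.adelicFin) (x : (M μ hμ).HB),
      jH μ hμ ((M μ hμ).ρB g x) = MonoidAlgebra.of ℂ ↥V.adelicFin g • jH μ hμ x)
    (hcm : ∀ (μ : T.Char) (hμ : T.PhiMu μ) (K : HodgeCM.Level V)
      (φ : (toThm418Data C (R μ hμ)).HomK K.K (M μ hμ).Dμ),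
      res K (jH μ hμ ((M μ hμ).ι
        (((M μ hμ).P ((toThm418Data C (R μ hμ)).res K.K (M μ hμ).Dμ φ)).baseChange ℂ (M μ hμ).α))) ∈ cmCl K μ)
    (hnvD : ∀ (μ : T.Char) (hμ : T.PhiMu μ) (i : (toThm418Data C (R μ hμ)).AdmIndex),
      Nontrivial ((toThm418Data C (R μ hμ)).omegaAt i))
    (hmultD : ∀ (μ : T.Char) (hμ : T.PhiMu μ) (i : (toThm418Data C (R μ hμ)).AdmIndex),
      Module.rank ℂ (Representation.IntertwiningMap ((toThm418Data C (R μ hμ)).rhoAt i)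
        (Representation.ofModule' (k := ℂ) (G := ↥V.adelicFin) T.H)) ≤ 1) :
    T.Thm418Combined res cmCl := by
  refine thm418Combined_of_thm418AsPrintedC_summands_pkg V h Φ C T res cmCl R hLiu σ hσ e he
    (fun μ hμ => jH μ hμ ∘ₗ (M μ hμ).toMap43Data.J) ?_ ?_ (fun μ hμ => (M μ hμ).Dμ) ?_ hnvD hmultD
  · -- (iii) «(4.3) is injective» (l. 2250–2268): a THEOREM over the rational record, then the injective reading `jH`
    intro μ hμ
    haveI := (M μ hμ).finite_rat_L
    exact (hjHinj μ hμ).comp (M μ hμ).injective_J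
  · -- (ii) «`ℂ[𝔾(𝔸_F^∞)]`-linear» (l. 2250): `Map43RationalData.hJ`, then the equivariance of `jH`
    intro μ hμ g x
    show jH μ hμ ((M μ hμ).toMap43Data.J _) = _
    rw [(M μ hμ).hJ]
    exact hjH μ hμ g _
  · -- (C) the class identification THROUGH (4.3) at `z = 1` is the contract on Liu's own classes (`J_tmul`)
    intro μ hμ K φ
    show res K (jH μ hμ ((M μ hμ).toMap43Data.J _)) ∈ _
    rw [(M μ hμ).J_tmul, one_smul]
    exact hcm μ hμ K φ

end LiuAlbaneseModuleDatum

end HodgeCM.Literature.Theta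

end
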